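import Mathlib.Data.Matrix.Mul
import Mathlib.Data.Real.Basic
import Mathlib.Algebra.Order.BigOperators.Group.Finset
import HarnessLib

/-!
# Simulation certificates for products of nonnegative matrices (weighted automata)
# (Sahi programme, prover prim-sahi-p2 gen 61)

Support file (`--supports stmt-CriticalPhenomena-4575`, helper).  Standard axioms, no sorries, no definitions (the product
`M₁ ⋯ M_k ω` is written `List.foldr (fun M v => M *ᵥ v) ω`).  Memo `run/shared/lean/prim/prim-sahi/FROM-prim-sahi-p2-gen61-TRANSFER-MATRIX.md` §2.

The cycle composition of the (P)-programme (gen 60) writes the three fibre counts of a boundary-star cycle of ANY length `k` as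
values of weighted automata, `bad = α ⬝ M(y₁) ⋯ M(y_k) ⬝ ω`, `#P1 = α₁ ⬝ N₁(y₁) ⋯ N₁(y_k) ⬝ ω₁`, `#P2` likewise (gen 61, `lab/tm.py`,
validated against the brute-force engine).  The inequality `bad² ≤ #P1·#P2` for all `k` then follows from a SIMULATION CERTIFICATE:
nonnegative matrices `X_i` with `α⊗α ≤ (α₁⊗α₂) X₀`, `X_{i-1} (M⊗M)(y_i) ≤ (N₁⊗N₂)(y_i) X_i` and `X_k (ω⊗ω) ≤ ω₁⊗ω₂` entrywise.
This file proves the abstract principle (for arbitrary index types and any ordered commutative semiring):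
* **`mulVec_foldr_le`** [this work; folklore for weighted automata] — vector form: `X₀ *ᵥ (M₁ ⋯ M_k ω) ≤ M'₁ ⋯ M'_k ω'`.
* **`simulation_le`** [this work; folklore] — `α ⬝ᵥ (M₁ ⋯ M_k ω) ≤ α' ⬝ᵥ (M'₁ ⋯ M'_k ω')` from a chain of simulation matrices.
* **`simulation_le_const`** — the same with one constant simulation matrix `X` (time-homogeneous certificate).
[folklore] (forward simulations of weighted automata over ordered semirings).
-/

namespace Summit.CriticalPhenomena.PercolationContinuityZ3.Theorems.ProductFormSimulation

open Matrix BigOperators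

variable {ι κ R : Type*} [Fintype ι] [Fintype κ] [CommSemiring R] [PartialOrder R] [IsOrderedRing R]

omit [Fintype κ] in
/-- A nonnegative matrix acts monotonically on vectors. [folklore] -/
theorem mulVec_le_mulVec_of_nonneg {M : Matrix κ ι R} (hM : ∀ i j, 0 ≤ M i j) {v w : ι → R} (hvw : v ≤ w) :
    M *ᵥ v ≤ M *ᵥ w := by
  intro i
  simp only [Matrix.mulVec, dotProduct]
  exact Finset.sum_le_sum fun j _ => mul_le_mul_of_nonneg_left (hvw j) (hM i j)

omit [Fintype κ] in
/-- A nonnegative matrix maps nonnegative vectors to nonnegative vectors. [folklore] -/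
theorem mulVec_nonneg {M : Matrix κ ι R} (hM : ∀ i j, 0 ≤ M i j) {v : ι → R} (hv : 0 ≤ v) : 0 ≤ M *ᵥ v := by
  intro i
  simp only [Matrix.mulVec, dotProduct, Pi.zero_apply]
  exact Finset.sum_nonneg fun j _ => mul_nonneg (hM i j) (hv j)

omit [Fintype κ] in
/-- Entrywise comparison of matrices gives comparison of their actions on a nonnegative vector. [folklore] -/
theorem mulVec_le_mulVec_of_le {A B : Matrix κ ι R} (hAB : ∀ i j, A i j ≤ B i j) {v : ι → R} (hv : 0 ≤ v) :
    A *ᵥ v ≤ B *ᵥ v := by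
  intro i
  simp only [Matrix.mulVec, dotProduct]
  exact Finset.sum_le_sum fun j _ => mul_le_mul_of_nonneg_right (hAB i j) (hv j)

/-- The vector `M₁ ⋯ M_k ω` is nonnegative when all the matrices and `ω` are. [folklore] -/
theorem foldr_mulVec_nonneg (Ms : List (Matrix ι ι R)) (hMs : ∀ M ∈ Ms, ∀ i j, 0 ≤ M i j) {ω : ι → R} (hω : 0 ≤ ω) :
    0 ≤ Ms.foldr (fun M v => M *ᵥ v) ω := by
  induction Ms with
  | nil => simpa using hω
  | cons M Ms ih =>
    rw [List.foldr_cons]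
    exact mulVec_nonneg (hMs M List.mem_cons_self)
      (ih fun N hN => hMs N (List.mem_cons_of_mem _ hN))

/-- **Vector form of the simulation principle.**  If `X₀ ω ≤ ω'` … more precisely: given lists `Ms`, `Ms'` of the same length,
simulation matrices `X : ℕ → Matrix κ ι R` with `X i * Ms[i] ≤ Ms'[i] * X (i+1)` entrywise and `X k *ᵥ ω ≤ ω'` (`k` the length),
all `Ms`, `Ms'` nonnegative and `ω ≥ 0`, then `X 0 *ᵥ (M₁ ⋯ M_k ω) ≤ M'₁ ⋯ M'_k ω'`. [this work; folklore] -/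
theorem mulVec_foldr_le (Ms : List (Matrix ι ι R)) (Ms' : List (Matrix κ κ R)) (hlen : Ms.length = Ms'.length)
    (X : ℕ → Matrix κ ι R) (ω : ι → R) (ω' : κ → R)
    (hMs : ∀ M ∈ Ms, ∀ i j, 0 ≤ M i j) (hMs' : ∀ M' ∈ Ms', ∀ i j, 0 ≤ M' i j) (hω : 0 ≤ ω)
    (hstep : ∀ i (hi : i < Ms.length), ∀ a b,
      (X i * Ms.get ⟨i, hi⟩) a b ≤ (Ms'.get ⟨i, hlen ▸ hi⟩ * X (i + 1)) a b)
    (hend : X Ms.length *ᵥ ω ≤ ω') :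
    X 0 *ᵥ Ms.foldr (fun M v => M *ᵥ v) ω ≤ Ms'.foldr (fun M v => M *ᵥ v) ω' := by
  induction Ms generalizing Ms' X with
  | nil =>
    cases Ms' with
    | nil => simpa using hend
    | cons _ _ => simp at hlen
  | cons M Ms ih =>
    cases Ms' with
    | nil => simp at hlen
    | cons M' Ms' =>
      simp only [List.length_cons, Nat.add_right_cancel_iff] at hlen
      rw [List.foldr_cons, List.foldr_cons, Matrix.mulVec_mulVec]
      have hv : 0 ≤ Ms.foldr (fun M v => M *ᵥ v) ω := foldr_mulVec_nonneg Ms (fun N hN => hMs N (List.mem_cons_of_mem _ hN)) hω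
      have h0 : (X 0 * M) *ᵥ Ms.foldr (fun M v => M *ᵥ v) ω ≤ (M' * X 1) *ᵥ Ms.foldr (fun M v => M *ᵥ v) ω := by
        refine mulVec_le_mulVec_of_le (fun a b => ?_) hv
        have := hstep 0 (by simp) a b
        simpa using this
      refine le_trans h0 ?_
      rw [← Matrix.mulVec_mulVec]
      refine mulVec_le_mulVec_of_nonneg (hMs' M' List.mem_cons_self) ?_
      refine ih Ms' hlen (fun i => X (i + 1)) (fun N hN => hMs N (List.mem_cons_of_mem _ hN))
        (fun N hN => hMs' N (List.mem_cons_of_mem _ hN)) ?_ ?_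
      · intro i hi a b
        have := hstep (i + 1) (by simpa using Nat.succ_lt_succ hi) a b
        simpa using this
      · simpa using hend

/-- `α ⬝ᵥ v ≤ β ⬝ᵥ v` when `α ≤ β` and `v ≥ 0`. [folklore] -/
theorem dotProduct_le_dotProduct_of_le_left {α β v : ι → R} (hαβ : α ≤ β) (hv : 0 ≤ v) :
    α ⬝ᵥ v ≤ β ⬝ᵥ v :=
  Finset.sum_le_sum fun j _ => mul_le_mul_of_nonneg_right (hαβ j) (hv j)

/-- `α ⬝ᵥ v ≤ α ⬝ᵥ w` when `v ≤ w` and `α ≥ 0`. [folklore] -/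
theorem dotProduct_le_dotProduct_of_le_right {α v w : ι → R} (hα : 0 ≤ α) (hvw : v ≤ w) :
    α ⬝ᵥ v ≤ α ⬝ᵥ w :=
  Finset.sum_le_sum fun j _ => mul_le_mul_of_nonneg_left (hvw j) (hα j)

/-- **The simulation principle for weighted automata.**  With `Ms`, `Ms'` nonnegative lists of the same length `k`, `α' ≥ 0`, `ω ≥ 0`,
and simulation matrices `X i` (`i = 0..k`) such that `α ≤ α' ᵥ* X 0`, `X i * Ms[i] ≤ Ms'[i] * X (i+1)` and `X k *ᵥ ω ≤ ω'` entrywise,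
the automaton values compare: `α ⬝ᵥ (M₁ ⋯ M_k ω) ≤ α' ⬝ᵥ (M'₁ ⋯ M'_k ω')`. [this work; folklore] -/
theorem simulation_le (Ms : List (Matrix ι ι R)) (Ms' : List (Matrix κ κ R)) (hlen : Ms.length = Ms'.length)
    (X : ℕ → Matrix κ ι R) (α ω : ι → R) (α' ω' : κ → R)
    (hMs : ∀ M ∈ Ms, ∀ i j, 0 ≤ M i j) (hMs' : ∀ M' ∈ Ms', ∀ i j, 0 ≤ M' i j) (hω : 0 ≤ ω) (hα' : 0 ≤ α')
    (hstart : α ≤ α' ᵥ* X 0)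
    (hstep : ∀ i (hi : i < Ms.length), ∀ a b,
      (X i * Ms.get ⟨i, hi⟩) a b ≤ (Ms'.get ⟨i, hlen ▸ hi⟩ * X (i + 1)) a b)
    (hend : X Ms.length *ᵥ ω ≤ ω') :
    α ⬝ᵥ Ms.foldr (fun M v => M *ᵥ v) ω ≤ α' ⬝ᵥ Ms'.foldr (fun M v => M *ᵥ v) ω' := by
  have hv : 0 ≤ Ms.foldr (fun M v => M *ᵥ v) ω := foldr_mulVec_nonneg Ms hMs hω
  calc α ⬝ᵥ Ms.foldr (fun M v => M *ᵥ v) ω ≤ (α' ᵥ* X 0) ⬝ᵥ Ms.foldr (fun M v => M *ᵥ v) ω := dotProduct_le_dotProduct_of_le_left hstart hv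
    _ = α' ⬝ᵥ (X 0 *ᵥ Ms.foldr (fun M v => M *ᵥ v) ω) := by rw [Matrix.dotProduct_mulVec]
    _ ≤ α' ⬝ᵥ Ms'.foldr (fun M v => M *ᵥ v) ω' :=
        dotProduct_le_dotProduct_of_le_right hα' (mulVec_foldr_le Ms Ms' hlen X ω ω' hMs hMs' hω hstep hend)

/-- **Time-homogeneous simulation certificate.**  One nonnegativity-free matrix `X` with `α ≤ α' ᵥ* X`, `X * M ≤ M' * X` for every
pair of corresponding letters and `X *ᵥ ω ≤ ω'` bounds every word: `α ⬝ᵥ (M₁ ⋯ M_k ω) ≤ α' ⬝ᵥ (M'₁ ⋯ M'_k ω')` for ALL `k`.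
(The certificate shape of the boundary-star cycle inequality, gen 61.) [this work; folklore] -/
theorem simulation_le_const (Ms : List (Matrix ι ι R)) (Ms' : List (Matrix κ κ R)) (hlen : Ms.length = Ms'.length)
    (X : Matrix κ ι R) (α ω : ι → R) (α' ω' : κ → R)
    (hMs : ∀ M ∈ Ms, ∀ i j, 0 ≤ M i j) (hMs' : ∀ M' ∈ Ms', ∀ i j, 0 ≤ M' i j) (hω : 0 ≤ ω) (hα' : 0 ≤ α')
    (hstart : α ≤ α' ᵥ* X)
    (hstep : ∀ i (hi : i < Ms.length), ∀ a b,
      (X * Ms.get ⟨i, hi⟩) a b ≤ (Ms'.get ⟨i, hlen ▸ hi⟩ * X) a b)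
    (hend : X *ᵥ ω ≤ ω') :
    α ⬝ᵥ Ms.foldr (fun M v => M *ᵥ v) ω ≤ α' ⬝ᵥ Ms'.foldr (fun M v => M *ᵥ v) ω' :=
  simulation_le Ms Ms' hlen (fun _ => X) α ω α' ω' hMs hMs' hω hα' hstart hstep hend

end Summit.CriticalPhenomena.PercolationContinuityZ3.Theorems.ProductFormSimulation
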